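import Summits.ValiantsHypothesis.ValiantsHypothesis.Theses.ScaledPencil
import Literature.Computability.AlgebraicComplexity.DeterminantalComplexityProofs

/-!
# Route ScaledPencil — NfToDc (glue)

Closes item stmt-ValiantsHypothesis-5323 (`NfToDc`) of route
`route-ValiantsHypothesis-ScaledPencil`: the bookkeeping implication

  `NormalForm → ScaledPencilNoQP → DcPerNotQP`.

If `dc(per_n) ≤ 2 ^ ((log₂ n + c) ^ c)` for all `n` (`IsQPBounded`), take `n := n₀(c)` from
`ScaledPencilNoQP c`. Since `dc` is attained
(`Literature.Computability.AlgebraicComplexity.hasDetRepr_determinantalComplexity_holds`),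
`per_n` has an affine determinantal representation of size `dc(per_n)`; `NormalForm` turns it
into a normal-form pencil of some size `m' ≤ dc(per_n)`, and `ScaledPencilNoQP` gives
`2 ^ ((log₂ n + c) ^ c) < m'`, contradicting the assumed bound.
-/

namespace Summit.ValiantsHypothesis.ScaledPencil

open Summit.ValiantsHypothesis.ValiantsHypothesis.Theses.ScaledPencil
open Literature.Computability.AlgebraicComplexity

/-- The glue of route ScaledPencil (closes item stmt-ValiantsHypothesis-5323): the normal-form
theorem `NormalForm` and the target `ScaledPencilNoQP` together give `DcPerNotQP`, i.e. the
determinantal complexity of the permanent family is not quasi-polynomially bounded. Pure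
bookkeeping over the proved fact that `dc` is attained
(`hasDetRepr_determinantalComplexity_holds`). -/
theorem nfToDc_proof :
    Summit.ValiantsHypothesis.ValiantsHypothesis.Theses.ScaledPencil.NfToDc := by
  unfold NfToDc DcPerNotQP
  intro hNF hX hQP
  obtain ⟨c, hc⟩ := hQP
  obtain ⟨n₀, hn₀⟩ := hX c
  have hdc : HasDetRepr (perPoly (Fin n₀) ℂ) (determinantalComplexity (perPoly (Fin n₀) ℂ)) :=
    hasDetRepr_determinantalComplexity_holds (perPoly (Fin n₀) ℂ)
  obtain ⟨m', hm', Λ, L, hdet, hscaled, hstable⟩ := hNF n₀ _ hdc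
  have hlt : 2 ^ ((Nat.log 2 n₀ + c) ^ c) < m' := hn₀ n₀ le_rfl m' Λ L hdet hscaled hstable
  have hle : determinantalComplexity (perPoly (Fin n₀) ℂ) ≤ 2 ^ ((Nat.log 2 n₀ + c) ^ c) := hc n₀
  omega

end Summit.ValiantsHypothesis.ScaledPencil
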